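import Mathlib.Analysis.InnerProductSpace.NormDet
import Mathlib.Analysis.InnerProductSpace.Continuous
import Mathlib.MeasureTheory.Measure.Haar.InnerProductSpace
import Mathlib.MeasureTheory.Constructions.BorelSpace.ContinuousLinearMap
import Mathlib.Analysis.Calculus.InverseFunctionTheorem.ApproximatesLinearOn
import Mathlib.Analysis.SpecialFunctions.Pow.Real
import Mathlib.Topology.Instances.Matrix
import Literature.MeasureTheory.Hausdorff.SphericalCap
import HarnessLib

/-!
# Hausdorff measure of almost linear images, in terms of `LinearMap.normDet`

Support file for the area formula in positive codimension (Federer 3.2.3 for maps with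
injective differential), itself a brick of the proof of the named fact
`Literature.Geometry.Kaehler.Harvey1977_boundary_toCurrent_eq_zero`. Everything is proved from
Mathlib; no definitions, no named facts.

The `d`-dimensional Jacobian of a linear map `A : P →L[ℝ] V` out of a `d`-dimensional real
inner product space is Mathlib's `LinearMap.normDet` (`(det (Aᵀ A))^{1/2}`, Federer's
`J_d = ‖∧_d A‖`), with `LinearMap.euclideanHausdorffMeasure_image :
μHE[d] (A '' t) = ENNReal.ofReal A.normDet * μHE[d] t`. This file adds:

* `continuous_normDet` — `A ↦ normDet A` is continuous on `P →L[ℝ] V` (it is the square root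
  of the Gram determinant `det ⟪A bᵢ, A bⱼ⟫`, `LinearMap.normDet_sq_eq_det_gram`).
* `euclideanHausdorffMeasure_image_le_of_approximatesLinearOn`,
  `normDet_mul_le_of_approximatesLinearOn` — if `g` is `δ`-approximately the `K`-antilipschitz
  linear map `A` on `t` (Mathlib's `ApproximatesLinearOn g A t δ`), then
  `(1 - Kδ)ᵈ J 𝓗ᵈ(t) ≤ 𝓗ᵈ(g(t)) ≤ (1 + Kδ)ᵈ J 𝓗ᵈ(t)`, `J = normDet A`: Federer's
  "`f(B) = [(f|B) ∘ s⁻¹] s(B)` implies `λ⁻ᵐ 𝓗ᵐ[s(B)] ≤ 𝓗ᵐ[f(B)] ≤ λᵐ 𝓗ᵐ[s(B)]`" (proof of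
  3.2.3), with `LipschitzOnWith.hausdorffMeasure_image_le`.
* `euclideanHausdorffMeasure_image_le_mul_of_normDet_lt`,
  `mul_le_euclideanHausdorffMeasure_image_of_lt_normDet` — the same in the shape of Mathlib's
  `addHaar_image_le_mul_of_det_lt` / `mul_le_addHaar_image_of_lt_det` (for injective `A`): for
  `m > J` (`m < J`) and all small `δ`, `𝓗ᵈ(g(t)) ≤ m vol(t)` (`m vol(t) ≤ 𝓗ᵈ(g(t))`).
* `approximatesLinearOn_of_norm_sub_le`, `isOpen_setOf_injective` — two general lemmas.

## References

* H. Federer, *Geometric Measure Theory*, Springer 1969, 3.2.1–3.2.3 (held copy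
  `lit book:federernd-geometric-measure-theory`, PDF pp. 206–208).
-/

noncomputable section

open MeasureTheory MeasureTheory.Measure Set Function Filter Metric Module Topology
open scoped ENNReal NNReal InnerProductSpace

namespace Literature.Analysis.Calculus

/-! ### Two general lemmas -/

section General

variable {E : Type*} [NormedAddCommGroup E] [NormedSpace ℝ E]
  {F : Type*} [NormedAddCommGroup F] [NormedSpace ℝ F]

/-- A linear map `B` with `‖B - A‖ ≤ δ` is `δ`-approximately `A` on every set. [folklore] -/
theorem approximatesLinearOn_of_norm_sub_le {A B : E →L[ℝ] F} {δ : ℝ≥0} (h : ‖B - A‖ ≤ δ)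
    (t : Set E) : ApproximatesLinearOn B A t δ := fun x _ y _ => by
  rw [← map_sub, show B (x - y) - A (x - y) = (B - A) (x - y) from rfl]
  exact ((B - A).le_opNorm _).trans (by gcongr)

/-- **Injective linear maps out of a finite-dimensional space form an open set** (an
antilipschitz map stays injective under perturbations of norm `< K⁻¹`). [folklore] -/
theorem isOpen_setOf_injective [FiniteDimensional ℝ E] : IsOpen {A : E →L[ℝ] F | Injective A} := by
  rw [isOpen_iff_mem_nhds]
  intro A hA
  obtain ⟨K, hKpos, hK⟩ := (A : E →ₗ[ℝ] F).injective_iff_antilipschitz.1 hA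
  replace hK : AntilipschitzWith K A := hK
  have hKr : (0 : ℝ) < K := by exact_mod_cast hKpos
  refine mem_of_superset (Metric.ball_mem_nhds A (inv_pos.2 hKr)) fun B hB => ?_
  rw [Metric.mem_ball, dist_eq_norm] at hB
  intro x y hxy
  have h1 : ‖x - y‖ ≤ K * ‖A x - A y‖ := by
    rw [← dist_eq_norm, ← dist_eq_norm]; exact hK.le_mul_dist x y
  have h2 : ‖A x - A y‖ ≤ ‖B - A‖ * ‖x - y‖ := by
    have : A x - A y = -((B - A) (x - y)) := by
      simp only [show (B - A) (x - y) = B (x - y) - A (x - y) from rfl, map_sub, hxy]; abel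
    rw [this, norm_neg]
    exact (B - A).le_opNorm _
  have h4 : (K : ℝ) * ‖B - A‖ < 1 := by
    calc (K : ℝ) * ‖B - A‖ < K * (K : ℝ)⁻¹ := by gcongr
      _ = 1 := mul_inv_cancel₀ hKr.ne'
  have h3 : ‖x - y‖ ≤ K * ‖B - A‖ * ‖x - y‖ := by
    calc ‖x - y‖ ≤ K * ‖A x - A y‖ := h1
      _ ≤ K * (‖B - A‖ * ‖x - y‖) := by gcongr
      _ = K * ‖B - A‖ * ‖x - y‖ := by ring
  have : ‖x - y‖ = 0 := by nlinarith [norm_nonneg (x - y)]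
  exact sub_eq_zero.1 (norm_eq_zero.1 this)

end General

/-! ### Continuity of `normDet` -/

section NormDet

variable {P : Type*} [NormedAddCommGroup P] [InnerProductSpace ℝ P] [FiniteDimensional ℝ P]
  {V : Type*} [NormedAddCommGroup V] [InnerProductSpace ℝ V]

/-- `normDet` as the square root of a Gram determinant. [folklore] -/
theorem normDet_eq_sqrt_det_gram (A : P →L[ℝ] V) :
    (A : P →ₗ[ℝ] V).normDet =
      Real.sqrt (Matrix.gram ℝ (fun i => A (stdOrthonormalBasis ℝ P i))).det := by
  classical
  have h := (A : P →ₗ[ℝ] V).normDet_sq_eq_det_gram (stdOrthonormalBasis ℝ P)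
  rw [RCLike.ofReal_real_eq_id, id_eq] at h
  rw [← Real.sqrt_sq (LinearMap.normDet_nonneg (A : P →ₗ[ℝ] V)), h]
  rfl

/-- **`A ↦ normDet A` is continuous** (the Gram determinant `det ⟪A bᵢ, A bⱼ⟫` is a polynomial in
`A`). [cite: Federer1969, 3.2.1] -/
theorem continuous_normDet : Continuous fun A : P →L[ℝ] V => (A : P →ₗ[ℝ] V).normDet := by
  classical
  simp_rw [normDet_eq_sqrt_det_gram]
  refine Real.continuous_sqrt.comp (Continuous.matrix_det ?_)
  refine continuous_matrix fun i j => ?_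
  simp only [Matrix.gram, Matrix.of_apply]
  exact ((ContinuousLinearMap.apply ℝ V (stdOrthonormalBasis ℝ P i)).continuous).inner
    ((ContinuousLinearMap.apply ℝ V (stdOrthonormalBasis ℝ P j)).continuous)

/-- `A ↦ ENNReal.ofReal (normDet A)` is measurable. [folklore] -/
theorem measurable_ofReal_normDet :
    Measurable fun A : P →L[ℝ] V => ENNReal.ofReal (A : P →ₗ[ℝ] V).normDet :=
  ENNReal.measurable_ofReal.comp continuous_normDet.measurable

end NormDet

/-! ### Almost linear images: Federer's `λ^{±m}` estimates -/

section Estimates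

variable {P : Type*} [NormedAddCommGroup P] [InnerProductSpace ℝ P] [FiniteDimensional ℝ P]
  [MeasurableSpace P] [BorelSpace P]
  {V : Type*} [NormedAddCommGroup V] [InnerProductSpace ℝ V] [MeasurableSpace V] [BorelSpace V]

/-- **Upper estimate** ("`𝓗ᵐ[f(B)] ≤ λᵐ 𝓗ᵐ[s(B)]`"): if `g` is `δ`-approximately the
`K`-antilipschitz linear map `A` on `t`, then `g(t)` is the image of `A(t)` under the map
`g ∘ A⁻¹`, which is `(1 + Kδ)`-Lipschitz there; hence
`𝓗ᵈ(g(t)) ≤ (1 + Kδ)ᵈ · normDet A · 𝓗ᵈ(t)`. [cite: Federer1969, 3.2.3 (proof)] -/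
theorem euclideanHausdorffMeasure_image_le_of_approximatesLinearOn {A : P →L[ℝ] V} {K δ : ℝ≥0}
    (hA : AntilipschitzWith K A) {g : P → V} {t : Set P} (hg : ApproximatesLinearOn g A t δ) :
    μHE[finrank ℝ P] (g '' t) ≤ ((1 + K * δ : ℝ≥0) : ℝ≥0∞) ^ finrank ℝ P *
      (ENNReal.ofReal (A : P →ₗ[ℝ] V).normDet * μHE[finrank ℝ P] t) := by
  classical
  rcases t.eq_empty_or_nonempty with rfl | ⟨x₀, hx₀⟩
  · simp
  haveI : Nonempty P := ⟨x₀⟩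
  -- `h = g ∘ A⁻¹` on `A(t)`
  set h : V → V := g ∘ invFunOn A t with hh
  have hinv : ∀ x ∈ t, invFunOn A t (A x) = x := fun x hx =>
    hA.injective (invFunOn_eq (f := (A : P → V)) ⟨x, hx, rfl⟩)
  have himage : h '' (A '' t) = g '' t := by
    rw [image_image]
    exact image_congr fun x hx => by simp [hh, hinv x hx]
  have hlip : LipschitzOnWith (1 + K * δ) h (A '' t) := by
    refine LipschitzOnWith.of_dist_le_mul fun y₁ hy₁ y₂ hy₂ => ?_
    obtain ⟨x₁, hx₁, rfl⟩ := hy₁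
    obtain ⟨x₂, hx₂, rfl⟩ := hy₂
    simp only [hh, comp_apply, hinv x₁ hx₁, hinv x₂ hx₂, dist_eq_norm]
    have h1 : ‖g x₁ - g x₂ - A (x₁ - x₂)‖ ≤ δ * ‖x₁ - x₂‖ := hg x₁ hx₁ x₂ hx₂
    have h2 : ‖x₁ - x₂‖ ≤ K * ‖A x₁ - A x₂‖ := by
      rw [← dist_eq_norm, ← dist_eq_norm]; exact hA.le_mul_dist x₁ x₂
    have h3 : ‖g x₁ - g x₂‖ ≤ ‖A (x₁ - x₂)‖ + ‖g x₁ - g x₂ - A (x₁ - x₂)‖ := norm_le_insert' _ _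
    have h4 : (δ : ℝ) * ‖x₁ - x₂‖ ≤ δ * (K * ‖A x₁ - A x₂‖) :=
      mul_le_mul_of_nonneg_left h2 δ.coe_nonneg
    have hAsub : ‖A (x₁ - x₂)‖ = ‖A x₁ - A x₂‖ := by rw [map_sub]
    push_cast
    linarith [h1, h3, h4, hAsub]
  have hlin : μHE[finrank ℝ P] (A '' t) =
      ENNReal.ofReal (A : P →ₗ[ℝ] V).normDet * μHE[finrank ℝ P] t :=
    (A : P →ₗ[ℝ] V).euclideanHausdorffMeasure_image t
  calc μHE[finrank ℝ P] (g '' t) = μHE[finrank ℝ P] (h '' (A '' t)) := by rw [himage]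
    _ ≤ ((1 + K * δ : ℝ≥0) : ℝ≥0∞) ^ finrank ℝ P * μHE[finrank ℝ P] (A '' t) :=
        hlip.euclideanHausdorffMeasure_image_le _
    _ = _ := by rw [hlin]

/-- **Lower estimate** ("`λ⁻ᵐ 𝓗ᵐ[s(B)] ≤ 𝓗ᵐ[f(B)]`"): if `g` is `δ`-approximately the
`K`-antilipschitz linear map `A` on `t` and `Kδ < 1`, then `A(t)` is the image of `g(t)` under
`A ∘ g⁻¹`, which is `(1 - Kδ)⁻¹`-Lipschitz there; hence
`normDet A · 𝓗ᵈ(t) ≤ (1 - Kδ)⁻ᵈ · 𝓗ᵈ(g(t))`. [cite: Federer1969, 3.2.3 (proof)] -/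
theorem normDet_mul_le_of_approximatesLinearOn {A : P →L[ℝ] V} {K δ : ℝ≥0}
    (hA : AntilipschitzWith K A) {g : P → V} {t : Set P} (hg : ApproximatesLinearOn g A t δ)
    (hKδ : K * δ < 1) :
    ENNReal.ofReal (A : P →ₗ[ℝ] V).normDet * μHE[finrank ℝ P] t ≤
      (((1 - K * δ)⁻¹ : ℝ≥0) : ℝ≥0∞) ^ finrank ℝ P * μHE[finrank ℝ P] (g '' t) := by
  classical
  rcases t.eq_empty_or_nonempty with rfl | ⟨x₀, hx₀⟩
  · simp
  haveI : Nonempty P := ⟨x₀⟩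
  have hKδ' : ((K : ℝ) * δ) < 1 := by exact_mod_cast hKδ
  have hpos : (0 : ℝ) < 1 - K * δ := by linarith
  -- the key inequality `(1 - Kδ) ‖A x₁ - A x₂‖ ≤ ‖g x₁ - g x₂‖` on `t`
  have key : ∀ x₁ ∈ t, ∀ x₂ ∈ t, (1 - K * δ) * ‖A x₁ - A x₂‖ ≤ ‖g x₁ - g x₂‖ := by
    intro x₁ hx₁ x₂ hx₂
    have h1 : ‖g x₁ - g x₂ - A (x₁ - x₂)‖ ≤ δ * ‖x₁ - x₂‖ := hg x₁ hx₁ x₂ hx₂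
    have h2 : ‖x₁ - x₂‖ ≤ K * ‖A x₁ - A x₂‖ := by
      rw [← dist_eq_norm, ← dist_eq_norm]; exact hA.le_mul_dist x₁ x₂
    have h3 : ‖A (x₁ - x₂)‖ ≤ ‖g x₁ - g x₂‖ + ‖g x₁ - g x₂ - A (x₁ - x₂)‖ := by
      have := norm_le_insert' (A (x₁ - x₂)) (g x₁ - g x₂)
      rwa [norm_sub_rev (A (x₁ - x₂))] at this
    have h4 : (δ : ℝ) * ‖x₁ - x₂‖ ≤ δ * (K * ‖A x₁ - A x₂‖) :=
      mul_le_mul_of_nonneg_left h2 δ.coe_nonneg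
    have hAsub : ‖A (x₁ - x₂)‖ = ‖A x₁ - A x₂‖ := by rw [map_sub]
    linarith [h1, h3, h4, hAsub]
  -- `g` is injective on `t`
  have hginj : InjOn g t := by
    intro x₁ hx₁ x₂ hx₂ hgx
    have := key x₁ hx₁ x₂ hx₂
    rw [hgx, sub_self, norm_zero] at this
    have h0 : ‖A x₁ - A x₂‖ ≤ 0 := by
      by_contra hne
      push Not at hne
      have : 0 < (1 - K * δ) * ‖A x₁ - A x₂‖ := mul_pos hpos hne
      linarith
    exact hA.injective (sub_eq_zero.1 (norm_le_zero_iff.1 h0))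
  -- `h' = A ∘ g⁻¹` on `g(t)`
  set h' : V → V := A ∘ invFunOn g t with hh'
  have hinv : ∀ x ∈ t, invFunOn g t (g x) = x := fun x hx =>
    hginj (invFunOn_mem (f := g) ⟨x, hx, rfl⟩) hx (invFunOn_eq (f := g) ⟨x, hx, rfl⟩)
  have himage : h' '' (g '' t) = A '' t := by
    rw [image_image]
    exact image_congr fun x hx => by simp [hh', hinv x hx]
  have hc : (((1 - K * δ)⁻¹ : ℝ≥0) : ℝ) = (1 - (K : ℝ) * δ)⁻¹ := by
    rw [NNReal.coe_inv, NNReal.coe_sub hKδ.le]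
    push_cast
    ring
  have hlip : LipschitzOnWith (1 - K * δ)⁻¹ h' (g '' t) := by
    refine LipschitzOnWith.of_dist_le_mul fun y₁ hy₁ y₂ hy₂ => ?_
    obtain ⟨x₁, hx₁, rfl⟩ := hy₁
    obtain ⟨x₂, hx₂, rfl⟩ := hy₂
    simp only [hh', comp_apply, hinv x₁ hx₁, hinv x₂ hx₂, dist_eq_norm]
    rw [hc, inv_mul_eq_div, le_div_iff₀ hpos, mul_comm]
    exact key x₁ hx₁ x₂ hx₂
  have hlin : μHE[finrank ℝ P] (A '' t) =
      ENNReal.ofReal (A : P →ₗ[ℝ] V).normDet * μHE[finrank ℝ P] t :=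
    (A : P →ₗ[ℝ] V).euclideanHausdorffMeasure_image t
  calc ENNReal.ofReal (A : P →ₗ[ℝ] V).normDet * μHE[finrank ℝ P] t
      = μHE[finrank ℝ P] (h' '' (g '' t)) := by rw [himage, hlin]
    _ ≤ _ := hlip.euclideanHausdorffMeasure_image_le _

/-! ### The estimates in the shape of Mathlib's `addHaar_image_le_mul_of_det_lt` -/

/-- **Images of almost linear maps do not expand `𝓗ᵈ` by more than `normDet`, up to `ε`**: for
injective `A` and `m > normDet A`, every map `δ`-approximately `A` on `t`, `δ` small, has
`𝓗ᵈ(g(t)) ≤ m · vol(t)` (the analogue of Mathlib's `addHaar_image_le_mul_of_det_lt`).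
[cite: Federer1969, 3.2.3 (proof)] -/
theorem euclideanHausdorffMeasure_image_le_mul_of_normDet_lt {A : P →L[ℝ] V} (hA : Injective A)
    {m : ℝ≥0} (hm : ENNReal.ofReal (A : P →ₗ[ℝ] V).normDet < m) :
    ∀ᶠ δ in 𝓝[>] (0 : ℝ≥0), ∀ (t : Set P) (g : P → V), ApproximatesLinearOn g A t δ →
      μHE[finrank ℝ P] (g '' t) ≤ (m : ℝ≥0∞) * volume t := by
  obtain ⟨K, -, hK⟩ := (A : P →ₗ[ℝ] V).injective_iff_antilipschitz.1 hA
  replace hK : AntilipschitzWith K A := hK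
  set j : ℝ≥0 := ((A : P →ₗ[ℝ] V).normDet).toNNReal with hj_def
  have hj : ENNReal.ofReal (A : P →ₗ[ℝ] V).normDet = j := rfl
  have hjm : j < m := by rw [hj] at hm; exact_mod_cast hm
  have T1 : Tendsto (fun δ : ℝ≥0 => (1 + K * δ) ^ finrank ℝ P * j) (𝓝 0) (𝓝 j) := by
    have hc : Continuous fun δ : ℝ≥0 => (1 + K * δ) ^ finrank ℝ P * j := by fun_prop
    simpa using hc.tendsto 0
  have E1 : ∀ᶠ δ : ℝ≥0 in 𝓝 0, (1 + K * δ) ^ finrank ℝ P * j < m := T1.eventually_lt_const hjm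
  filter_upwards [mem_nhdsWithin_of_mem_nhds E1] with δ hδ t g hg
  calc μHE[finrank ℝ P] (g '' t) ≤ ((1 + K * δ : ℝ≥0) : ℝ≥0∞) ^ finrank ℝ P *
        (ENNReal.ofReal (A : P →ₗ[ℝ] V).normDet * μHE[finrank ℝ P] t) :=
      euclideanHausdorffMeasure_image_le_of_approximatesLinearOn hK hg
    _ = (((1 + K * δ) ^ finrank ℝ P * j : ℝ≥0) : ℝ≥0∞) * volume t := by
      rw [hj, InnerProductSpace.euclideanHausdorffMeasure_eq_volume]
      simp only [ENNReal.coe_mul, ENNReal.coe_pow, mul_assoc]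
    _ ≤ (m : ℝ≥0∞) * volume t := by
      have : (((1 + K * δ) ^ finrank ℝ P * j : ℝ≥0) : ℝ≥0∞) ≤ m := by exact_mod_cast hδ.le
      gcongr

/-- **Images of almost linear maps do not contract `𝓗ᵈ` by more than `normDet`, up to `ε`**:
for injective `A` and `m < normDet A`, every map `δ`-approximately `A` on `t`, `δ` small, has
`m · vol(t) ≤ 𝓗ᵈ(g(t))` (the analogue of Mathlib's `mul_le_addHaar_image_of_lt_det`).
[cite: Federer1969, 3.2.3 (proof)] -/
theorem mul_le_euclideanHausdorffMeasure_image_of_lt_normDet {A : P →L[ℝ] V} (hA : Injective A)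
    {m : ℝ≥0} (hm : (m : ℝ≥0∞) < ENNReal.ofReal (A : P →ₗ[ℝ] V).normDet) :
    ∀ᶠ δ in 𝓝[>] (0 : ℝ≥0), ∀ (t : Set P) (g : P → V), ApproximatesLinearOn g A t δ →
      (m : ℝ≥0∞) * volume t ≤ μHE[finrank ℝ P] (g '' t) := by
  obtain ⟨K, -, hK⟩ := (A : P →ₗ[ℝ] V).injective_iff_antilipschitz.1 hA
  replace hK : AntilipschitzWith K A := hK
  set j : ℝ≥0 := ((A : P →ₗ[ℝ] V).normDet).toNNReal with hj_def
  have hj : ENNReal.ofReal (A : P →ₗ[ℝ] V).normDet = j := rfl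
  have hmj : m < j := by rw [hj] at hm; exact_mod_cast hm
  have T1 : Tendsto (fun δ : ℝ≥0 => (1 - K * δ) ^ finrank ℝ P * j) (𝓝 0) (𝓝 j) := by
    have hc : Continuous fun δ : ℝ≥0 => (1 - K * δ) ^ finrank ℝ P * j := by fun_prop
    simpa using hc.tendsto 0
  have T2 : Tendsto (fun δ : ℝ≥0 => K * δ) (𝓝 0) (𝓝 0) := by
    have hc : Continuous fun δ : ℝ≥0 => K * δ := by fun_prop
    simpa using hc.tendsto 0
  have E1 : ∀ᶠ δ : ℝ≥0 in 𝓝 0, m < (1 - K * δ) ^ finrank ℝ P * j := T1.eventually_const_lt hmj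
  have E2 : ∀ᶠ δ : ℝ≥0 in 𝓝 0, K * δ < 1 := T2.eventually_lt_const one_pos
  filter_upwards [mem_nhdsWithin_of_mem_nhds E1, mem_nhdsWithin_of_mem_nhds E2] with δ hδ hKδ t g
    hg
  have hL := normDet_mul_le_of_approximatesLinearOn hK hg hKδ
  rw [hj, InnerProductSpace.euclideanHausdorffMeasure_eq_volume] at hL
  -- `(1 - Kδ)ᵈ (1 - Kδ)⁻ᵈ = 1`
  have hone : (1 - K * δ) ^ finrank ℝ P * ((1 - K * δ)⁻¹) ^ finrank ℝ P = 1 := by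
    rw [← mul_pow, mul_inv_cancel₀ (tsub_pos_of_lt hKδ).ne', one_pow]
  calc (m : ℝ≥0∞) * volume t ≤ (((1 - K * δ) ^ finrank ℝ P * j : ℝ≥0) : ℝ≥0∞) * volume t := by
        have : (m : ℝ≥0∞) ≤ (((1 - K * δ) ^ finrank ℝ P * j : ℝ≥0) : ℝ≥0∞) := by
          exact_mod_cast hδ.le
        gcongr
    _ = (((1 - K * δ) ^ finrank ℝ P : ℝ≥0) : ℝ≥0∞) * ((j : ℝ≥0∞) * volume t) := by
        simp only [ENNReal.coe_mul, ENNReal.coe_pow, mul_assoc]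
    _ ≤ (((1 - K * δ) ^ finrank ℝ P : ℝ≥0) : ℝ≥0∞) *
          ((((1 - K * δ)⁻¹ : ℝ≥0) : ℝ≥0∞) ^ finrank ℝ P * μHE[finrank ℝ P] (g '' t)) := by
        gcongr
    _ = (((1 - K * δ) ^ finrank ℝ P * ((1 - K * δ)⁻¹) ^ finrank ℝ P : ℝ≥0) : ℝ≥0∞) *
          μHE[finrank ℝ P] (g '' t) := by
        simp only [ENNReal.coe_mul, ENNReal.coe_pow, mul_assoc]
    _ = μHE[finrank ℝ P] (g '' t) := by rw [hone, ENNReal.coe_one, one_mul]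

end Estimates

end Literature.Analysis.Calculus
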